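import Literature.AnabelianGeometry.SemiGraphs.ArithThm54CapstonesChartOfProducers
import HarnessLib

/-!
# [SemiAnbd] Rmk 5.3.1 (first sentence) AT `π₁^temp(𝒢) ⋊^out Π_A` FOR THE CHART OF A COFINAL GALOIS TOWER WITH
# CHARACTERISTIC LEVELS — the producer `hR`, with every landed producer bound by name (corollary-integrator; proof-only)

Mochizuki, *Semi-graphs of anabelioids*, Publ. RIMS **42** (2006) 221–322, §5 Rmk 5.3.1 p. 65 ("all verticial and
edge-like subgroups of `Π^temp_𝔊` are compact and arithmetically ample"), Def 5.1 (i) p. 62, Prop 5.2 (iv) p. 64,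
Thm 5.4 (ii)/(iii) p. 66; §3 Prop 3.6 p. 38 [cite: MochizukiSemiAnbd2006, Rmk 5.3.1, p. 65].

PROOF-ONLY file (abc-iut cell, layer L3, sub-DAG `plan/L3/SUBDAG-SemiAnbd-Thm54.md`, producer row T54-B =
`plan/GAP-LEDGER.md` G-w4d053-1; row «T54·COROLLARY-INTEGRATOR», seat abc-iut-w4-d089 gen 6).  No definition, no new
named fact, no producer restated.  abc-iut-w5-d141's Thm 5.4 (iii) umbrella (`…_ofChartDict`, p436919) and this
seat's outer-model instance of it (`arithQuasiGeometricCorrespondenceStatementCompat_outerModel`, p438883) consume,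
next to Thm 5.4 (ii) at the two outer models (`hIIG`/`hIIH` = the `.2` of abc-iut-w4-d029's
`arithMaximalCompactStatement_outerAction_piPresentation_chart_of_producers`, p436631), Rmk 5.3.1's first sentence
there (`hRG`/`hRH : VerticialEdgeLikeCompactAmpleStatement …`).  Its producer is abc-iut-w4-d040's generic
`verticialEdgeLikeCompactAmple_outerAction_cosetTowerC` (ArithThm54iiBindersOuterAction.lean) — bound INSIDE p436631's
proof but not exposed.  Here it is EXPOSED as a named theorem at the chart `D.chart …` of ANY cofinal Galois tower
`D` with characteristic finite levels, with exactly p436631's producer bindings: `hP :=` abc-iut-w4-d053's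
`isArithCompatible_piPresentation_outerAction_of_branchPair_chart_of_finite`, `hKst`/`hLst :=` abc-iut-L3-t9's
`hKst_and_hLst_of_ker_piLevelAut_eq_charOpenCore`, `hnobpNCpt :=` abc-iut-w4-d053's
`hnobpNCpt_cosetTower_of_faithV_chart`, the tower inputs `piPresentation_hT/hHK/hMK/hlift/hliftE/hfree`,
`finite_quotient_ker_piLevelAut`, `ker_projAut_anti`, `ker_piLevelAut_anti`, `ker_projAut_le_ker_piLevelAut`,
`isOpen_ker_projAut`, and `PointSeq.range_decompHom_mem_verticialSubgroups_chart` /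
`piPresentation_M_mem_edgeLikeSubgroups_chart` (abc-iut-w4-d053).

* `verticialEdgeLikeCompactAmple_outerAction_chart_of_producers` — Rmk 5.3.1 at the outer model over `D.chart …`,
  the LEVEL-B topology kept as raw binders (`[TopologicalSpace E] [IsTopologicalGroup E]`, `hT`, `hb`, `hK1′`,
  `hKopen`) — the binder list of p436631 VERBATIM minus `hest`/`hbot`/`[T2Space E]` (not needed for Rmk 5.3.1).

HONEST RESIDUAL: design data `hV hE hopen hBR`, characteristic levels `hker`, (I0v) `hfaithV`, the level-B topology
items, `noSwitchBase`, (AI4″) `stabBranchPairAug`, the profinite frame of `Π_A`.  Nothing beyond composition is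
proved here; typed ≠ proved for the residual inputs; Rmk 5.3.1 for OUR tower decomposition; no side taken on
[IUTchIII] Cor. 3.12.
-/

namespace Literature.AnabelianGeometry.SemiGraphs

namespace ProfiniteSemiGraph

open CategoryTheory Topology Filter
open Literature.AnabelianGeometry.EtaleTheta
open scoped Pointwise

universe u

variable {𝒢 : ProfiniteSemiGraph.{u}} (D : GaloisLevelData 𝒢) (h𝒢 : 𝒢.IsCountable)
  (hcof : ∀ (T : CovObj 𝒢), T.IsTempered → ∀ p : T.Point,
    ∃ i : ℕ, ∀ j, i ≤ j → (D.S j).Splits (T.component p))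
  (hcn : 𝒢.graph.IsConnected) (hS : ∀ n, (D.S n).Splits (D.S n)) (hfin : ∀ n, (D.S n).IsFinite)
  (hne : ∀ n, (D.S n).HasNonemptyFibres)
  (hconn : ∀ (n : ℕ) (p q : (D.S n).Point), (D.S n).SameComponent p q)

/-- **[SemiAnbd] Rmk 5.3.1, first sentence, at `π₁^temp(𝒢) ⋊^out Π_A` for the chart of a cofinal Galois tower with
characteristic levels — abc-iut-w4-d040's producer with every landed input bound by name** (the `hR` input of
Thm 5.4 (ii)/(iii) at the outer model; composition identical to the `hR` step of abc-iut-w4-d029's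
`arithMaximalCompactStatement_outerAction_piPresentation_chart_of_producers`, exposed as a theorem).
[cite: MochizukiSemiAnbd2006, Rmk 5.3.1, p. 65] -/
theorem verticialEdgeLikeCompactAmple_outerAction_chart_of_producers
    (h37 : 𝒢.Thm37Hypotheses) (hG : 𝒢.graph.IsGraph) [Finite 𝒢.graph.Vertex] [Finite 𝒢.graph.Branch]
    [Finite 𝒢.graph.Edge]
    {PA : Type u} [Group PA] [TopologicalSpace PA] [IsTopologicalGroup PA] [CompactSpace PA]
    (ρ' : PA →* TopOut (D.chart h𝒢 hcof hcn hS hfin hne).G) (baseAct : PA →* Aut 𝒢.graph)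
    [TopologicalSpace (outerSemidirectProduct ρ')] [IsTopologicalGroup (outerSemidirectProduct ρ')]
    (T : ∀ w : 𝒢.graph.Vertex, D.PointSeq h𝒢 w) (R : SemiGraph.RefBranches 𝒢.graph)
    (Rc : ChartRepresentatives (D.chart h𝒢 hcof hcn hS hfin hne))
    -- Prop 3.6 (iv) at `ρ_𝔾(a)` / Def 5.1 (i)(c): the DESIGN data of the outer model (abc-iut-w4-d082's currency)
    (hV : ∀ (a : PA) (v : 𝒢.graph.Vertex) (H : Subgroup (D.chart h𝒢 hcof hcn hS hfin hne).G), H ∈ verticialSubgroups (D.chart h𝒢 hcof hcn hS hfin hne) v →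
      ∃ φ : contMulAut (D.chart h𝒢 hcof hcn hS hfin hne).G, TopOut.mk _ φ = ρ' a ∧
        H.map (φ : MulAut (D.chart h𝒢 hcof hcn hS hfin hne).G).toMonoidHom ∈ verticialSubgroups (D.chart h𝒢 hcof hcn hS hfin hne) ((baseAct a).hom.vertexMap v))
    (hE : ∀ (a : PA) (e : 𝒢.graph.Edge) (K : Subgroup (D.chart h𝒢 hcof hcn hS hfin hne).G), K ∈ edgeLikeSubgroups (D.chart h𝒢 hcof hcn hS hfin hne) e →
      ∃ φ : contMulAut (D.chart h𝒢 hcof hcn hS hfin hne).G, TopOut.mk _ φ = ρ' a ∧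
        K.map (φ : MulAut (D.chart h𝒢 hcof hcn hS hfin hne).G).toMonoidHom ∈ edgeLikeSubgroups (D.chart h𝒢 hcof hcn hS hfin hne) ((baseAct a).hom.edgeMap e))
    (hopen : ∃ U : Subgroup PA, IsOpen (U : Set PA) ∧ ∀ a ∈ U,
      (∀ v, (baseAct a).hom.vertexMap v = v) ∧ (∀ e, (baseAct a).hom.edgeMap e = e) ∧
        ∀ b, (baseAct a).hom.branchMap b = b)
    (hBR : ∀ (a : PA) (b : 𝒢.graph.Branch) (v : 𝒢.graph.Vertex) (hb : 𝒢.graph.abuts b = some v)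
      (φ : 𝒢.Gv v →ₜ* (D.chart h𝒢 hcof hcn hS hfin hne).G), IsVerticialHom (D.chart h𝒢 hcof hcn hS hfin hne) v φ →
      ∃ Φ : contMulAut (D.chart h𝒢 hcof hcn hS hfin hne).G, TopOut.mk _ Φ = ρ' a ∧
        ∃ φ' : 𝒢.Gv ((baseAct a).hom.vertexMap v) →ₜ* (D.chart h𝒢 hcof hcn hS hfin hne).G,
          IsVerticialHom (D.chart h𝒢 hcof hcn hS hfin hne) ((baseAct a).hom.vertexMap v) φ' ∧
          ∃ x' : (D.chart h𝒢 hcof hcn hS hfin hne).G,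
            Subgroup.map (Φ : MulAut (D.chart h𝒢 hcof hcn hS hfin hne).G).toMonoidHom φ.toMonoidHom.range =
              Subgroup.map (MulAut.conj x').toMonoidHom φ'.toMonoidHom.range ∧
            Subgroup.map (Φ : MulAut (D.chart h𝒢 hcof hcn hS hfin hne).G).toMonoidHom
                (Subgroup.map φ.toMonoidHom (𝒢.branchSubgroup b v hb)) =
              Subgroup.map (MulAut.conj x').toMonoidHom
                (Subgroup.map φ'.toMonoidHom
                  (𝒢.branchSubgroup ((baseAct a).hom.branchMap b) ((baseAct a).hom.vertexMap v)
                    ((baseAct a).hom.abuts_branchMap b v hb))))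
    (w₀ : 𝒢.graph.Vertex)
    -- CHARACTERISTIC finite levels (abc-iut-L3-t9 E1): `ker π_n` is the characteristic open core of level `d n`
    (d : ℕ → ℕ) (hker : ∀ n, (D.piLevelAut h𝒢 hconn n).ker = charOpenCore (D.temperedPi h𝒢) (d n))
    -- (I0v) for the tower `D`: every `𝒢_v` acts faithfully on the `v`-fibres of the levels (abc-iut-w4-d053's
    -- `faithfulV_ofOpenNormalSeq` at the prescribed open-normal / characteristic tower)
    (hfaithV : ∀ (v : 𝒢.graph.Vertex) (h : 𝒢.Gv v),
      (∀ (n : ℕ) (x : ((D.S n).SV v).obj.V), ((D.S n).SV v).obj.ρ h x = x) → h = 1)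
    -- the LEVEL-B topology on `E` (abc-iut-w6-d070's `arithLevelTopology` terms, v2): tempered, abc-iut-L3-d2's
    -- neighbourhood basis, `hK1′`, open tree-level action kernels — all at the DERIVED `hP`/`hKst` terms
    (hT : IsTempered (outerSemidirectProduct ρ'))
    (hb : (𝓝 (1 : outerSemidirectProduct ρ')).HasBasis (fun _ : ℕ × OpenNormalSubgroup PA => True)
      (fun nU => (((D.piPresentation h𝒢 T R).levelKer (isArithCompatible_piPresentation_outerAction_of_branchPair_chart_of_finite D h𝒢 hcof hcn hS hfin hne T R ρ' baseAct h37 hG hV hBR)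
        (D.projAut h𝒢 nU.1).ker ((D.hKst_and_hLst_of_ker_piLevelAut_eq_charOpenCore h𝒢 hconn T R ρ' (isArithCompatible_piPresentation_outerAction_of_branchPair_chart_of_finite D h𝒢 hcof hcn hS hfin hne T R ρ' baseAct h37 hG hV hBR) d hker).1 nU.1) ⊓
        nU.2.toSubgroup.comap (outerSemidirectProductSnd ρ') : Subgroup (outerSemidirectProduct ρ')) :
          Set (outerSemidirectProduct ρ'))))
    (hK1' : ∀ n, IsOpen ((((D.piPresentation h𝒢 T R).levelKer (isArithCompatible_piPresentation_outerAction_of_branchPair_chart_of_finite D h𝒢 hcof hcn hS hfin hne T R ρ' baseAct h37 hG hV hBR)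
        (D.projAut h𝒢 n).ker ((D.hKst_and_hLst_of_ker_piLevelAut_eq_charOpenCore h𝒢 hconn T R ρ' (isArithCompatible_piPresentation_outerAction_of_branchPair_chart_of_finite D h𝒢 hcof hcn hS hfin hne T R ρ' baseAct h37 hG hV hBR) d hker).1 n)).map (outerSemidirectProductSnd ρ') :
      Subgroup PA) : Set PA))
    (hKopen : ∀ n, IsOpen (((D.piPresentation h𝒢 T R).arithAct (isArithCompatible_piPresentation_outerAction_of_branchPair_chart_of_finite D h𝒢 hcof hcn hS hfin hne T R ρ' baseAct h37 hG hV hBR) (D.projAut h𝒢 n).ker ((D.hKst_and_hLst_of_ker_piLevelAut_eq_charOpenCore h𝒢 hconn T R ρ' (isArithCompatible_piPresentation_outerAction_of_branchPair_chart_of_finite D h𝒢 hcof hcn hS hfin hne T R ρ' baseAct h37 hG hV hBR) d hker).1 n)).ker : Set (outerSemidirectProduct ρ')))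
    (noSwitchBase : NoBranchSwitching 𝒢.graph.edgeOf
      (fun (a : PA) (b : 𝒢.graph.Branch) => (baseAct a).hom.branchMap b))
    (stabBranchPairAug : ∀ (C : Subgroup (outerSemidirectProduct ρ')),
      IsCompact (C : Set (outerSemidirectProduct ρ')) →
      ∀ (j₀ : ℕ) (w : ∀ i : {i : ℕ // j₀ ≤ i}, ((D.piPresentation h𝒢 T R).cosetGraph (D.piLevelAut h𝒢 hconn i.1).ker).Vertex)
      (β β' : ∀ i : {i : ℕ // j₀ ≤ i}, ((D.piPresentation h𝒢 T R).cosetGraph (D.piLevelAut h𝒢 hconn i.1).ker).Branch),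
      (∀ i, β i ≠ β' i ∧ ((D.piPresentation h𝒢 T R).cosetGraph (D.piLevelAut h𝒢 hconn i.1).ker).abuts (β i) = some (w i) ∧
        ((D.piPresentation h𝒢 T R).cosetGraph (D.piLevelAut h𝒢 hconn i.1).ker).abuts (β' i) = some (w i)) →
      (∀ ⦃i i' : {i : ℕ // j₀ ≤ i}⦄ (h : i.1 ≤ i'.1),
        ((D.piPresentation h𝒢 T R).cosetGraphTrans (D.ker_piLevelAut_anti h𝒢 hconn h)).vertexMap (w i') = w i ∧
        ((D.piPresentation h𝒢 T R).cosetGraphTrans (D.ker_piLevelAut_anti h𝒢 hconn h)).branchMap (β i') = β i ∧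
          ((D.piPresentation h𝒢 T R).cosetGraphTrans (D.ker_piLevelAut_anti h𝒢 hconn h)).branchMap (β' i') = β' i) →
      (∀ (i : {i : ℕ // j₀ ≤ i}) (g : outerSemidirectProduct ρ'), g ∈ C →
        ((D.piPresentation h𝒢 T R).arithAct (isArithCompatible_piPresentation_outerAction_of_branchPair_chart_of_finite D h𝒢 hcof hcn hS hfin hne T R ρ' baseAct h37 hG hV hBR) (D.piLevelAut h𝒢 hconn i.1).ker ((D.hKst_and_hLst_of_ker_piLevelAut_eq_charOpenCore h𝒢 hconn T R ρ' (isArithCompatible_piPresentation_outerAction_of_branchPair_chart_of_finite D h𝒢 hcof hcn hS hfin hne T R ρ' baseAct h37 hG hV hBR) d hker).2 i.1) g).hom.vertexMap (w i) = w i ∧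
        ((D.piPresentation h𝒢 T R).arithAct (isArithCompatible_piPresentation_outerAction_of_branchPair_chart_of_finite D h𝒢 hcof hcn hS hfin hne T R ρ' baseAct h37 hG hV hBR) (D.piLevelAut h𝒢 hconn i.1).ker ((D.hKst_and_hLst_of_ker_piLevelAut_eq_charOpenCore h𝒢 hconn T R ρ' (isArithCompatible_piPresentation_outerAction_of_branchPair_chart_of_finite D h𝒢 hcof hcn hS hfin hne T R ρ' baseAct h37 hG hV hBR) d hker).2 i.1) g).hom.branchMap (β i) = β i ∧
          ((D.piPresentation h𝒢 T R).arithAct (isArithCompatible_piPresentation_outerAction_of_branchPair_chart_of_finite D h𝒢 hcof hcn hS hfin hne T R ρ' baseAct h37 hG hV hBR) (D.piLevelAut h𝒢 hconn i.1).ker ((D.hKst_and_hLst_of_ker_piLevelAut_eq_charOpenCore h𝒢 hconn T R ρ' (isArithCompatible_piPresentation_outerAction_of_branchPair_chart_of_finite D h𝒢 hcof hcn hS hfin hne T R ρ' baseAct h37 hG hV hBR) d hker).2 i.1) g).hom.branchMap (β' i) = β' i) →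
      ∃ (v : 𝒢.graph.Vertex) (b b' : 𝒢.graph.Branch) (a : PA) (h : outerSemidirectProduct ρ'),
        (decompositionDataOfChart Rc (toOuterSemidirectProduct ρ')).abut b = some v ∧ (decompositionDataOfChart Rc (toOuterSemidirectProduct ρ')).abut b' = some v ∧
        h ∈ (decompositionDataOfChart Rc (toOuterSemidirectProduct ρ')).vertGp v ∧ (b' ≠ b ∨ h ∉ (decompositionDataOfChart Rc (toOuterSemidirectProduct ρ')).brGp b) ∧
        C.map (outerSemidirectProductSnd ρ') ≤ conjSubgroup a (((decompositionDataOfChart Rc (toOuterSemidirectProduct ρ')).brGp b ⊓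
          conjSubgroup h ((decompositionDataOfChart Rc (toOuterSemidirectProduct ρ')).brGp b')).map (outerSemidirectProductSnd ρ')))
    :
    VerticialEdgeLikeCompactAmpleStatement (decompositionDataOfChart Rc (toOuterSemidirectProduct ρ'))
      (outerSemidirectProductSnd ρ') := by
  -- exactness of `1 → π₁^temp → E → Π_A → 1` (temp-slimness) at the chart of the tower
  obtain ⟨hι, hex, -⟩ := outerAction_exact (D.chart h𝒢 hcof hcn hS hfin hne) ρ' h37.toProp36Hypotheses
  have hιΦ : ∀ g : (D.chart h𝒢 hcof hcn hS hfin hne).G, (((contMulAut (D.chart h𝒢 hcof hcn hS hfin hne).G).subtype.comp (MonoidHom.fst (contMulAut (D.chart h𝒢 hcof hcn hS hfin hne).G) PA)).comp (outerSemidirectProduct ρ').subtype) ((toOuterSemidirectProduct ρ') g) = MulAut.conj g := fun _ => rfl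
  have hισ : ∀ g : (D.chart h𝒢 hcof hcn hS hfin hne).G, (baseAct.comp (outerSemidirectProductSnd ρ')) ((toOuterSemidirectProduct ρ') g) = 1 := fun g => by
    have hg : (toOuterSemidirectProduct ρ') g ∈ (outerSemidirectProductSnd ρ').ker := hex ▸ ⟨g, rfl⟩
    rw [MonoidHom.comp_apply, (MonoidHom.mem_ker).mp hg, map_one]
  have hPH : ∀ w, (D.piPresentation h𝒢 T R).H w ∈ verticialSubgroups (D.chart h𝒢 hcof hcn hS hfin hne) w := fun w => by
    rw [D.piPresentation_H h𝒢 T R]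
    exact (T w).range_decompHom_mem_verticialSubgroups_chart hcof hcn hS hfin hne
  -- `hnobpNCpt` (abc-iut-w4-d053's `_chart` transport of abc-iut-w4-d083's producer, mod (I0v) for `D`)
  have hnobpNCpt := hnobpNCpt_cosetTower_of_faithV_chart D h𝒢 hcof hcn hS hfin hne hconn T R h37
    (isArithCompatible_piPresentation_outerAction_of_branchPair_chart_of_finite D h𝒢 hcof hcn hS hfin hne T R ρ' baseAct h37 hG hV hBR)
    (D.hKst_and_hLst_of_ker_piLevelAut_eq_charOpenCore h𝒢 hconn T R ρ' (isArithCompatible_piPresentation_outerAction_of_branchPair_chart_of_finite D h𝒢 hcof hcn hS hfin hne T R ρ' baseAct h37 hG hV hBR) d hker).2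
    (toOuterSemidirectProduct ρ') hιΦ hισ hfaithV
  -- `hR` (abc-iut-w4-d040, generic in the chart and the presentation) at this tower's own package
  have hR := @verticialEdgeLikeCompactAmple_outerAction_cosetTowerC 𝒢 (D.chart h𝒢 hcof hcn hS hfin hne)
    PA _ _ ρ' baseAct _ _ _ _ h37 hG _ _ Rc hV hE hopen hBR
    (D.piPresentation h𝒢 T R) _
    (isArithCompatible_piPresentation_outerAction_of_branchPair_chart_of_finite D h𝒢 hcof hcn hS hfin hne T R ρ' baseAct h37 hG hV hBR)
    hιΦ hPH
    (fun ε => piPresentation_M_mem_edgeLikeSubgroups_chart D h𝒢 hcof hcn hS hfin hne T R ε) w₀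
    (fun n => (D.projAut h𝒢 n).ker) (fun _ => MonoidHom.normal_ker _) (D.ker_projAut_anti h𝒢)
    (D.hKst_and_hLst_of_ker_piLevelAut_eq_charOpenCore h𝒢 hconn T R ρ' (isArithCompatible_piPresentation_outerAction_of_branchPair_chart_of_finite D h𝒢 hcof hcn hS hfin hne T R ρ' baseAct h37 hG hV hBR) d hker).1
    (D.piPresentation_hT h𝒢 T R) hKopen noSwitchBase
    (D.piPresentation_hHK h𝒢 T R) (D.piPresentation_hMK h𝒢 T R)
    (D.piPresentation_hlift h𝒢 T R) (D.piPresentation_hliftE h𝒢 T R)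
    (fun n => (D.piLevelAut h𝒢 hconn n).ker) (fun _ => MonoidHom.normal_ker _)
    (fun j => D.finite_quotient_ker_piLevelAut h𝒢 hconn hfin j)
    (D.ker_piLevelAut_anti h𝒢 hconn)
    (D.hKst_and_hLst_of_ker_piLevelAut_eq_charOpenCore h𝒢 hconn T R ρ' (isArithCompatible_piPresentation_outerAction_of_branchPair_chart_of_finite D h𝒢 hcof hcn hS hfin hne T R ρ' baseAct h37 hG hV hBR) d hker).2
    (fun n => D.ker_projAut_le_ker_piLevelAut h𝒢 hconn n)
    (D.piPresentation_hfree h𝒢 hconn T R) hnobpNCpt stabBranchPairAug hT hb hK1'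
    (D.isOpen_ker_projAut h𝒢)
  exact hR

end ProfiniteSemiGraph

end Literature.AnabelianGeometry.SemiGraphs
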